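/-
Copyright: rh-split cell (screw, bridge) gen 16, 2026-08-27.  Splitting search over kernel-typed
RH-equivalences; this module is ζ-free analysis.  Nothing here bears on the truth of RH.
-/
import Summits.RiemannHypothesis.RiemannHypothesis.Theorems.Splittings.ScrewBorelGaussA
import Mathlib.Analysis.Complex.RemovableSingularity
import HarnessLib

/-!
# Gauss's law for a sign-definite Borel series — part B: Gauss's law, circles at every scale, lassos
(ζ-free kernel of row X-14; part A = `ScrewBorelGaussA`: slope terms, charges, flux)

Data as in `ScrewBorelContinuation` / `ScrewBorelFlux`: `c : ι → ℂ` absolutely summable with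
`Re (c i) < 0`, `u i ≠ 0`, the BOREL SERIES `B(z) = ∑' i, term (c i) (u i) z` and its INSIDE POLE SET
`poleSet u ⊆ 𝔻`.

**The slope series.**  `B(0) = 0`, and off the poles `term c u z = z · slopeTerm c u z` with
`slopeTerm c u z = c·((1/2)·((u⁻¹ - z)⁻¹ + (u - z)⁻¹) - (1 - z)⁻¹)` — a WOLFF–DENJOY series `∑ A/(q - z)`
whose residue at each pole `q ∈ {u⁻¹, u}` is the PURE CHARGE `-c/2`, without the positional factor `q`
that the flux `∮ B dz` of `ScrewBorelFlux.circleIntegral_term` carries (`discWeight = (c/2)·q`).  So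
`∮_{C(a,R)} slopeTerm c u = -2πi · chargeWeight c u a R`, `chargeWeight = (c/2)·#{poles of the term in
ball a R}` (§3), and the real part of the total charge enclosed by a circle is a sum of NON-POSITIVE
terms, strictly negative as soon as one pole is enclosed.

**Gauss's law** (`poleSet_inter_ball_eq_empty`, §6).  Let `F` be holomorphic on the unit disc and equal
to `B` on a pole-free disc `ball 0 r₀`.  If a circle `sphere a R` with `closedBall a R ⊆ 𝔻` lies in a
preconnected set `V ∋ 0`, `V ⊆ 𝔻 ∖ closure (poleSet u)`, then `ball a R` contains NO inside pole.
Proof: `G = dslope F 0` (the difference quotient `(F z - F 0)/z`, holomorphic on `𝔻` by the removable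
singularity theorem) agrees with the slope series on the punctured disc `ball 0 r₀ ∖ {0}` (§5), hence on
`V` (identity theorem); Cauchy gives `∮_{C(a,R)} G = 0`; term by term (§4) `∮ slope series =
-2πi · ∑' chargeWeight`; the real part of `∑' chargeWeight` is `< 0` if a pole is enclosed.  ONE circle, ANY
centre, ANY radius: no shrinking, no Tannery limit, no metric or topological hypothesis on the wall.

Corollaries (§7): the CIRCLES theorem of `ScrewBorelFlux` at every scale (`false_of_circle`; it implies
`ScrewBorelFlux.false_of_small_circles` and `ScrewBorel.not_mem_closure_of_isolated`); the LASSO form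
(`lt_norm_of_sphere_zero_subset`: an origin-centred circle `‖z‖ = r` linked to `0` off the wall forces every
inside pole OUTSIDE it, `r < ‖p‖`; `poleSet_eq_empty_of_lassos`); the component form with
`Ω₀ = connectedComponentIn (𝔻 ∖ closure (poleSet u)) 0`.

Classical background: the residues of a Borel–Wolff–Denjoy series `∑ Aₙ/(z - zₙ)`, `∑ |Aₙ| < ∞`, are
conserved under analytic continuation into a hole of the pole set (Wolff's 1921 example `∑ r_k²/(z - z_k) =
ρ²/(z - a)` off a packed disc carries the total charge `∑ r_k² = ρ²` to the pole `a`; Ross–Shapiro,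
Generalized Analytic Continuation, §4.2 and Thm 4.2.5 (Brown–Shields–Zeller)); with sign-definite
residues a continuation holomorphic on the WHOLE hole is therefore impossible.  RH-side reading (module
`ScrewLatticeGauss`): under `CEIL(h)` the aliased far zeros of ζ avoid every disc whose boundary circle lies in
the origin's component of `𝔻 ∖ T_h`.

No `sorry`, no new axioms, no instances, no notation.
-/

set_option linter.dupNamespace false

namespace Summit.RiemannHypothesis.RiemannHypothesis.Theorems.Splittings.ScrewBorelGauss

open Complex Filter Topology Set Metric MeasureTheory
open scoped Real
open Summit.RiemannHypothesis.RiemannHypothesis.Theorems.Splittings.ScrewBorel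
open Summit.RiemannHypothesis.RiemannHypothesis.Theorems.Splittings.ScrewBorelFlux

/-! ## 5. Near the origin the slope series is the difference quotient of `F` -/

/-- On the pole-free punctured disc `ball 0 r₀ ∖ {0}` (`r₀ ≤ 1`, `r₀ ≤ ‖p‖` for every inside pole), any
`F` equal to the Borel series on `ball 0 r₀` has `dslope F 0 = (F z - F 0)/z = ∑' slopeTerm`. -/
theorem eqOn_dslope_slopeSeries {ι : Type*} {c u : ι → ℂ} (hu : ∀ i, u i ≠ 0) {F : ℂ → ℂ}
    {r₀ : ℝ} (hr₀1 : r₀ ≤ 1) (hS : ∀ p ∈ poleSet u, r₀ ≤ ‖p‖)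
    (hFB : EqOn F (fun z ↦ ∑' i, term (c i) (u i) z) (ball 0 r₀)) :
    EqOn (dslope F 0) (fun z ↦ ∑' i, slopeTerm (c i) (u i) z) (ball 0 r₀ \ {0}) := by
  intro z hz
  have hz0 : z ≠ 0 := hz.2
  have hzr : ‖z‖ < r₀ := mem_ball_zero_iff.1 hz.1
  have hz1 : ‖z‖ < 1 := hzr.trans_le hr₀1
  have hr₀ : 0 < r₀ := (norm_nonneg z).trans_lt hzr
  have hden : ∀ i, 1 - u i * z ≠ 0 ∧ 1 - z / u i ≠ 0 ∧ (1 : ℂ) - z ≠ 0 := by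
    intro i
    refine ⟨fun h ↦ ?_, fun h ↦ ?_, fun h ↦ ?_⟩
    · have hz' : z = (u i)⁻¹ := eq_inv_of_mul_eq_one_right (sub_eq_zero.1 h).symm
      have hp : (u i)⁻¹ ∈ poleSet u := ⟨by rw [← hz']; exact hz1, i, Or.inr rfl⟩
      have := hS _ hp
      rw [← hz'] at this
      linarith
    · have hz' : z = u i := (div_eq_one_iff_eq (hu i)).1 (sub_eq_zero.1 h).symm
      have hp : u i ∈ poleSet u := ⟨by rw [← hz']; exact hz1, i, Or.inl rfl⟩
      have := hS _ hp
      rw [← hz'] at this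
      linarith
    · have hz' : z = 1 := ((sub_eq_zero.1 h)).symm
      rw [hz', norm_one] at hz1
      exact lt_irrefl _ hz1
  have hF0 : F 0 = 0 := by
    have h := hFB (mem_ball_self hr₀)
    rw [h]
    exact borel_zero c u
  have hFz : F z = z * ∑' i, slopeTerm (c i) (u i) z := by
    rw [hFB hz.1]
    show (∑' i, term (c i) (u i) z) = _
    rw [← tsum_mul_left]
    exact tsum_congr fun i ↦ term_eq_mul_slopeTerm (hu i) (hden i).1 (hden i).2.1 (hden i).2.2
  show dslope F 0 z = ∑' i, slopeTerm (c i) (u i) z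
  rw [dslope_of_ne _ hz0, slope_def_field, sub_zero, hF0, sub_zero, hFz, mul_div_cancel_left₀ _ hz0]

/-! ## 6. Gauss's law -/

/-- **GAUSS'S LAW (ζ-free).**  `c` absolutely summable with `Re cᵢ < 0`, `uᵢ ≠ 0`; `F` holomorphic on the
unit disc and equal to the Borel series on a pole-free disc `ball 0 r₀` (`0 < r₀ ≤ ‖p‖` for all inside
poles `p`).  If a circle `sphere a R` (`R > 0`, `closedBall a R ⊆ 𝔻`) lies in a preconnected set `V ∋ 0`
with `V ⊆ 𝔻 ∖ closure (poleSet u)`, then the open disc `ball a R` contains NO inside pole. -/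
theorem poleSet_inter_ball_eq_empty {ι : Type*} {c u : ι → ℂ} (hc : Summable fun i ↦ ‖c i‖)
    (hre : ∀ i, (c i).re < 0) (hu : ∀ i, u i ≠ 0) {F : ℂ → ℂ}
    (hF : DifferentiableOn ℂ F (ball 0 1)) {r₀ : ℝ} (hr₀ : 0 < r₀)
    (hS : ∀ p ∈ poleSet u, r₀ ≤ ‖p‖)
    (hFB : EqOn F (fun z ↦ ∑' i, term (c i) (u i) z) (ball 0 r₀))
    {V : Set ℂ} (hV : IsPreconnected V) (hV0 : (0 : ℂ) ∈ V)
    (hVsub : V ⊆ ball 0 1 \ closure (poleSet u))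
    {a : ℂ} {R : ℝ} (hR : 0 < R) (haR : closedBall a R ⊆ ball (0 : ℂ) 1) (hSV : sphere a R ⊆ V) :
    poleSet u ∩ ball a R = ∅ := by
  haveI : Countable ι := countable_of_summable_of_re_neg hc hre
  -- shrink `r₀` below `1`
  set r₁ : ℝ := min r₀ (1 / 2) with hr₁
  have hr₁0 : 0 < r₁ := lt_min hr₀ one_half_pos
  have hr₁1 : r₁ ≤ 1 := (min_le_right _ _).trans (by norm_num)
  have hS₁ : ∀ p ∈ poleSet u, r₁ ≤ ‖p‖ := fun p hp ↦ (min_le_left _ _).trans (hS p hp)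
  have hFB₁ : EqOn F (fun z ↦ ∑' i, term (c i) (u i) z) (ball 0 r₁) :=
    hFB.mono (ball_subset_ball (min_le_left _ _))
  have hclos : closure (poleSet u) ⊆ {q : ℂ | r₁ ≤ ‖q‖} :=
    closure_minimal (fun p hp ↦ hS₁ p hp) (isClosed_le continuous_const continuous_norm)
  -- the two holomorphic functions: `G = dslope F 0` on `𝔻`, the slope series off the wall
  set G : ℂ → ℂ := dslope F 0 with hG
  have hGd : DifferentiableOn ℂ G (ball 0 1) :=
    (Complex.differentiableOn_dslope (ball_mem_nhds (0 : ℂ) one_pos)).2 hF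
  have hOpen : IsOpen (ball (0 : ℂ) 1 \ closure (poleSet u)) := isOpen_ball.sdiff isClosed_closure
  have hSd := differentiableOn_slopeSeries (u := u) hc
  -- the linking set `V' = V ∪ ball 0 r₁` and the base point `z₀ = r₁/2`
  set V' : Set ℂ := V ∪ ball 0 r₁ with hV'
  have hV'sub : V' ⊆ ball 0 1 \ closure (poleSet u) := by
    rintro z (hz | hz)
    · exact hVsub hz
    · have hzn : ‖z‖ < r₁ := mem_ball_zero_iff.1 hz
      refine ⟨mem_ball_zero_iff.2 (hzn.trans_le hr₁1), fun hzcl ↦ ?_⟩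
      have := hclos hzcl
      simp only [mem_setOf_eq] at this
      linarith
  have hV'pc : IsPreconnected V' :=
    IsPreconnected.union' ⟨0, hV0, mem_ball_self hr₁0⟩ hV (convex_ball (0 : ℂ) r₁).isPreconnected
  set z₀ : ℂ := ((r₁ / 2 : ℝ) : ℂ) with hz₀
  have hz₀n : ‖z₀‖ = r₁ / 2 := by
    rw [hz₀, Complex.norm_real, Real.norm_eq_abs, abs_of_pos (half_pos hr₁0)]
  have hz₀V' : z₀ ∈ V' := Or.inr (mem_ball_zero_iff.2 (by rw [hz₀n]; linarith))
  have hev : G =ᶠ[𝓝 z₀] fun z ↦ ∑' i, slopeTerm (c i) (u i) z := by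
    refine Filter.eventuallyEq_of_mem (ball_mem_nhds z₀ (half_pos hr₁0)) fun w hw ↦ ?_
    refine eqOn_dslope_slopeSeries hu hr₁1 hS₁ hFB₁ ⟨?_, ?_⟩
    · rw [mem_ball, dist_eq_norm] at hw
      rw [mem_ball_zero_iff]
      calc ‖w‖ = ‖z₀ + (w - z₀)‖ := by congr 1; ring
        _ ≤ ‖z₀‖ + ‖w - z₀‖ := norm_add_le _ _
        _ < r₁ := by rw [hz₀n]; linarith
    · intro hw0
      rw [mem_singleton_iff] at hw0
      rw [hw0, mem_ball, dist_comm, dist_zero_right, hz₀n] at hw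
      exact lt_irrefl _ hw
  have hGan : AnalyticOnNhd ℂ G V' := ((hGd.mono fun z hz ↦ hz.1).analyticOnNhd hOpen).mono hV'sub
  have hSan : AnalyticOnNhd ℂ (fun z ↦ ∑' i, slopeTerm (c i) (u i) z) V' :=
    (hSd.analyticOnNhd hOpen).mono hV'sub
  have hEqV' : EqOn G (fun z ↦ ∑' i, slopeTerm (c i) (u i) z) V' :=
    hGan.eqOn_of_preconnected_of_eventuallyEq hSan hV'pc hz₀V' hev
  have hEqS : EqOn G (fun z ↦ ∑' i, slopeTerm (c i) (u i) z) (sphere a R) :=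
    hEqV'.mono (hSV.trans subset_union_left)
  -- separation of the circle from the wall, and a norm bound `r' < 1` on the circle
  have hdisj : Disjoint (sphere a R) (closure (poleSet u)) :=
    Set.disjoint_left.2 fun z hz hzcl ↦ (hVsub (hSV hz)).2 hzcl
  obtain ⟨δ₁, hδ₁, hsep⟩ := exists_separation (isCompact_sphere a R) hdisj
  obtain ⟨z₁, hz₁S, hz₁max⟩ := (isCompact_sphere a R).exists_isMaxOn
    ((NormedSpace.sphere_nonempty (E := ℂ)).2 hR.le) continuous_norm.continuousOn
  set r' : ℝ := ‖z₁‖ with hr'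
  have hr'1 : r' < 1 := mem_ball_zero_iff.1 (haR (sphere_subset_closedBall hz₁S))
  have hzr : ∀ z ∈ sphere a R, ‖z‖ ≤ r' := fun z hz ↦ hz₁max hz
  set δ : ℝ := min δ₁ (1 - r') with hδ
  have hδ0 : 0 < δ := lt_min hδ₁ (by linarith)
  have hδr : δ ≤ 1 - r' := min_le_right _ _
  have hfar : ∀ z ∈ sphere a R, ∀ q ∈ poleSet u, δ ≤ ‖q - z‖ :=
    fun z hz q hq ↦ (min_le_left _ _).trans (hsep z hz q hq)
  have hoff : ∀ q ∈ poleSet u, q ∉ sphere a R := fun q hq hqs ↦ by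
    have := hfar _ hqs q hq
    rw [sub_self, norm_zero] at this
    linarith
  -- `∮ slope series = ∑' ∮ slopeTermᵢ = -2πi · ∑' chargeWeightᵢ`
  have hsum := hasSum_circleIntegral_slope hc hR hδ0 hδr hzr hfar
  have hterm : ∀ i, (∮ z in C(a, R), slopeTerm (c i) (u i) z) =
      -(2 * π * I) * chargeWeight (c i) (u i) a R := by
    intro i
    refine circleIntegral_slopeTerm hR haR (fun h ↦ ?_) (fun h ↦ ?_)
    · exact hoff _ ⟨mem_ball_zero_iff.1 (haR (sphere_subset_closedBall h)), i, Or.inl rfl⟩ h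
    · exact hoff _ ⟨mem_ball_zero_iff.1 (haR (sphere_subset_closedBall h)), i, Or.inr rfl⟩ h
  -- `∮ slope series = ∮ G = 0`
  have hI0 : (∮ z in C(a, R), ∑' i, slopeTerm (c i) (u i) z) = 0 := by
    rw [← circleIntegral.integral_congr hR.le hEqS]
    exact circleIntegral_eq_zero_of_differentiable_on_off_countable hR.le countable_empty
      (hGd.continuousOn.mono haR)
      (fun z hz ↦ hGd.differentiableAt (isOpen_ball.mem_nhds (haR (ball_subset_closedBall hz.1))))
  have h2 : HasSum (fun i ↦ -(2 * π * I) * chargeWeight (c i) (u i) a R) 0 := by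
    have h := hsum
    simp_rw [hterm] at h
    rwa [hI0] at h
  have hWs : Summable fun i ↦ chargeWeight (c i) (u i) a R :=
    Summable.of_norm_bounded hc (fun i ↦ norm_chargeWeight_le _ _ _ _)
  have h3 : ∑' i, chargeWeight (c i) (u i) a R = 0 := by
    have h4 : -(2 * π * I) * ∑' i, chargeWeight (c i) (u i) a R = 0 := by
      rw [← tsum_mul_left]; exact h2.tsum_eq
    have h2pi : -(2 * π * I : ℂ) ≠ 0 := by
      refine neg_ne_zero.2 (mul_ne_zero (mul_ne_zero two_ne_zero ?_) I_ne_zero)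
      exact_mod_cast Real.pi_ne_zero
    exact (mul_eq_zero.1 h4).resolve_left h2pi
  -- sign: an enclosed pole would make the real part of the total charge negative
  refine Set.eq_empty_iff_forall_notMem.2 fun p hp ↦ ?_
  obtain ⟨hpS, hpB⟩ := hp
  have hpa : ‖p - a‖ < R := by rw [mem_ball, dist_eq_norm] at hpB; exact hpB
  obtain ⟨i₀, hi₀⟩ := hpS.2
  have hre_sum : Summable fun i ↦ (chargeWeight (c i) (u i) a R).re :=
    (Complex.hasSum_re hWs.hasSum).summable
  have hlt : ∑' i, (chargeWeight (c i) (u i) a R).re < ∑' _ : ι, (0 : ℝ) :=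
    hre_sum.tsum_lt_tsum (fun i ↦ re_chargeWeight_nonpos (hre i) _ _ _)
      (re_chargeWeight_neg (hre i₀) hpa hi₀) summable_zero
  rw [tsum_zero, ← Complex.re_tsum hWs, h3, Complex.zero_re] at hlt
  exact lt_irrefl _ hlt

/-! ## 7. Corollaries: circles at every scale, lassos, the origin's component -/

/-- **Circles theorem at every scale.**  Under the hypotheses of `poleSet_inter_ball_eq_empty`, no inside
pole lies inside a circle `sphere a R` (`closedBall a R ⊆ 𝔻`) contained in a preconnected `V ∋ 0`,
`V ⊆ 𝔻 ∖ closure (poleSet u)` — whatever the centre and the radius (this implies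
`ScrewBorelFlux.false_of_small_circles`, where the radii shrink to `0`, and `ScrewBorel.not_mem_closure_of_isolated`). -/
theorem false_of_circle {ι : Type*} {c u : ι → ℂ} (hc : Summable fun i ↦ ‖c i‖)
    (hre : ∀ i, (c i).re < 0) (hu : ∀ i, u i ≠ 0) {F : ℂ → ℂ}
    (hF : DifferentiableOn ℂ F (ball 0 1)) {r₀ : ℝ} (hr₀ : 0 < r₀)
    (hS : ∀ p ∈ poleSet u, r₀ ≤ ‖p‖)
    (hFB : EqOn F (fun z ↦ ∑' i, term (c i) (u i) z) (ball 0 r₀))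
    {V : Set ℂ} (hV : IsPreconnected V) (hV0 : (0 : ℂ) ∈ V)
    (hVsub : V ⊆ ball 0 1 \ closure (poleSet u))
    {a p : ℂ} {R : ℝ} (haR : closedBall a R ⊆ ball (0 : ℂ) 1) (hSV : sphere a R ⊆ V)
    (hp : p ∈ poleSet u) (hpa : p ∈ ball a R) : False := by
  have hR : 0 < R := by
    have h := mem_ball.1 hpa
    exact lt_of_le_of_lt dist_nonneg h
  have h := poleSet_inter_ball_eq_empty hc hre hu hF hr₀ hS hFB hV hV0 hVsub hR haR hSV
  have : p ∈ poleSet u ∩ ball a R := ⟨hp, hpa⟩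
  rw [h] at this
  exact this

/-- **Lasso form.**  If an origin-centred circle `‖z‖ = r` (`0 < r < 1`) lies in a preconnected `V ∋ 0`
inside `𝔻 ∖ closure (poleSet u)`, then every inside pole lies strictly OUTSIDE it: `r < ‖p‖`. -/
theorem lt_norm_of_sphere_zero_subset {ι : Type*} {c u : ι → ℂ} (hc : Summable fun i ↦ ‖c i‖)
    (hre : ∀ i, (c i).re < 0) (hu : ∀ i, u i ≠ 0) {F : ℂ → ℂ}
    (hF : DifferentiableOn ℂ F (ball 0 1)) {r₀ : ℝ} (hr₀ : 0 < r₀)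
    (hS : ∀ p ∈ poleSet u, r₀ ≤ ‖p‖)
    (hFB : EqOn F (fun z ↦ ∑' i, term (c i) (u i) z) (ball 0 r₀))
    {V : Set ℂ} (hV : IsPreconnected V) (hV0 : (0 : ℂ) ∈ V)
    (hVsub : V ⊆ ball 0 1 \ closure (poleSet u))
    {r : ℝ} (hr : 0 < r) (hr1 : r < 1) (hSV : sphere (0 : ℂ) r ⊆ V) :
    ∀ p ∈ poleSet u, r < ‖p‖ := by
  intro p hp
  have hcb : closedBall (0 : ℂ) r ⊆ ball 0 1 := closedBall_subset_ball hr1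
  have h := poleSet_inter_ball_eq_empty hc hre hu hF hr₀ hS hFB hV hV0 hVsub hr hcb hSV
  have hnot : p ∉ ball (0 : ℂ) r := fun hpb ↦ by
    have : p ∈ poleSet u ∩ ball 0 r := ⟨hp, hpb⟩
    rw [h] at this
    exact this
  have hne : ‖p‖ ≠ r := fun hpr ↦
    (hVsub (hSV (mem_sphere_zero_iff_norm.2 hpr))).2 (subset_closure hp)
  rw [mem_ball_zero_iff, not_lt] at hnot
  exact lt_of_le_of_ne hnot (Ne.symm hne)

/-- The origin's component `Ω₀ = connectedComponentIn (𝔻 ∖ closure (poleSet u)) 0` is a legitimate `V`: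
preconnected, inside `𝔻 ∖ closure (poleSet u)`, and it contains `0` as soon as `ball 0 r₀` is pole-free. -/
theorem zero_mem_component {ι : Type*} {u : ι → ℂ} {r₀ : ℝ} (hr₀ : 0 < r₀)
    (hS : ∀ p ∈ poleSet u, r₀ ≤ ‖p‖) :
    (0 : ℂ) ∈ connectedComponentIn (ball (0 : ℂ) 1 \ closure (poleSet u)) 0 := by
  refine mem_connectedComponentIn ⟨mem_ball_self one_pos, fun h0 ↦ ?_⟩
  have hclos : closure (poleSet u) ⊆ {q : ℂ | r₀ ≤ ‖q‖} :=
    closure_minimal (fun p hp ↦ hS p hp) (isClosed_le continuous_const continuous_norm)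
  have := hclos h0
  simp only [mem_setOf_eq, norm_zero] at this
  linarith

/-- **Gauss's law, component form.**  A circle `sphere a R` (`R > 0`, `closedBall a R ⊆ 𝔻`) contained in
the origin's component of `𝔻 ∖ closure (poleSet u)` bounds a disc free of inside poles. -/
theorem poleSet_inter_ball_eq_empty_of_component {ι : Type*} {c u : ι → ℂ}
    (hc : Summable fun i ↦ ‖c i‖) (hre : ∀ i, (c i).re < 0) (hu : ∀ i, u i ≠ 0) {F : ℂ → ℂ}
    (hF : DifferentiableOn ℂ F (ball 0 1)) {r₀ : ℝ} (hr₀ : 0 < r₀)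
    (hS : ∀ p ∈ poleSet u, r₀ ≤ ‖p‖)
    (hFB : EqOn F (fun z ↦ ∑' i, term (c i) (u i) z) (ball 0 r₀))
    {a : ℂ} {R : ℝ} (hR : 0 < R) (haR : closedBall a R ⊆ ball (0 : ℂ) 1)
    (hSV : sphere a R ⊆ connectedComponentIn (ball (0 : ℂ) 1 \ closure (poleSet u)) 0) :
    poleSet u ∩ ball a R = ∅ :=
  poleSet_inter_ball_eq_empty hc hre hu hF hr₀ hS hFB isPreconnected_connectedComponentIn
    (zero_mem_component hr₀ hS) (connectedComponentIn_subset _ _) hR haR hSV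

/-- **Lassos exhausting the disc force an empty pole set.**  If origin-centred circles `‖z‖ = r` with `r`
arbitrarily close to `1` lie in the origin's component of `𝔻 ∖ closure (poleSet u)`, there is no inside
pole at all. -/
theorem poleSet_eq_empty_of_lassos {ι : Type*} {c u : ι → ℂ}
    (hc : Summable fun i ↦ ‖c i‖) (hre : ∀ i, (c i).re < 0) (hu : ∀ i, u i ≠ 0) {F : ℂ → ℂ}
    (hF : DifferentiableOn ℂ F (ball 0 1)) {r₀ : ℝ} (hr₀ : 0 < r₀)
    (hS : ∀ p ∈ poleSet u, r₀ ≤ ‖p‖)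
    (hFB : EqOn F (fun z ↦ ∑' i, term (c i) (u i) z) (ball 0 r₀))
    (hlasso : ∀ η : ℝ, 0 < η → ∃ r ∈ Ioo (1 - η) 1,
      sphere (0 : ℂ) r ⊆ connectedComponentIn (ball (0 : ℂ) 1 \ closure (poleSet u)) 0) :
    poleSet u = ∅ := by
  refine Set.eq_empty_iff_forall_notMem.2 fun p hp ↦ ?_
  have hp1 : ‖p‖ < 1 := hp.1
  obtain ⟨r, hr, hrs⟩ := hlasso (1 - ‖p‖) (by linarith)
  have hr0 : 0 < r := by linarith [hr.1, norm_nonneg p]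
  have hlt := lt_norm_of_sphere_zero_subset hc hre hu hF hr₀ hS hFB isPreconnected_connectedComponentIn
    (zero_mem_component hr₀ hS) (connectedComponentIn_subset _ _) hr0 hr.2 hrs p hp
  linarith [hr.1]

/-! ## 8. Walls of zero length admit lassos (`X-14 ⊇ X-13′ ⊇ X-10`) -/

/-- A point of the circle `sphere x t` has norm at most `‖x‖ + t` (file-internal copy; the landed twin is
`Literature.Analysis.OperatorTheory.norm_le_norm_add_of_mem_sphere`). -/
private theorem norm_le_of_mem_sphere {x z : ℂ} {t : ℝ} (hz : z ∈ sphere x t) :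
    ‖z‖ ≤ ‖x‖ + t := by
  have h : ‖z - x‖ = t := by rw [← dist_eq_norm]; exact hz
  calc ‖z‖ = ‖x + (z - x)‖ := by congr 1; ring
    _ ≤ ‖x‖ + ‖z - x‖ := norm_add_le _ _
    _ = ‖x‖ + t := by rw [h]

/-- **Zero-length walls admit lassos.**  If `closure (poleSet u) ∩ 𝔻` has zero length and `ball 0 r₀` is
pole-free (`r₀ > 0`), then origin-centred circles `‖z‖ = R` with `R` arbitrarily close to `1` lie in the
origin's component of `𝔻 ∖ closure (poleSet u)` (two good radii and the intermediate value theorem; compare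
`ScrewBorelFlux.poleSet_eq_empty_of_hausdorffMeasure_zero`, which needed four pieces and shrinking radii). -/
theorem lassos_of_hausdorffMeasure_zero {ι : Type*} {u : ι → ℂ} {r₀ : ℝ} (hr₀ : 0 < r₀)
    (hS : ∀ p ∈ poleSet u, r₀ ≤ ‖p‖) (hH : μH[1] (closure (poleSet u) ∩ ball 0 1) = 0)
    {η : ℝ} (hη : 0 < η) :
    ∃ R ∈ Ioo (1 - η) 1,
      sphere (0 : ℂ) R ⊆ connectedComponentIn (ball (0 : ℂ) 1 \ closure (poleSet u)) 0 := by
  have hclos : closure (poleSet u) ⊆ {q : ℂ | r₀ ≤ ‖q‖} :=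
    closure_minimal (fun q hq ↦ hS q hq) (isClosed_le continuous_const continuous_norm)
  have h2 : 1 < Module.rank ℝ ℂ := by simp [Complex.rank_real_complex]
  have hgood : ∀ {x : ℂ} {t : ℝ}, (∀ z ∈ closure (poleSet u) ∩ ball 0 1, dist z x ≠ t) →
      ‖x‖ + t < 1 → sphere x t ⊆ ball 0 1 \ closure (poleSet u) := by
    intro x t ht h1 z hz
    have hz1 : ‖z‖ < 1 := (norm_le_of_mem_sphere hz).trans_lt h1
    exact ⟨mem_ball_zero_iff.2 hz1, fun hzcl ↦ ht z ⟨hzcl, mem_ball_zero_iff.2 hz1⟩ hz⟩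
  -- pole-free core radius `r₁ ≤ 1/2`
  set r₁ : ℝ := min r₀ (1 / 2) with hr₁
  have hr₁0 : 0 < r₁ := lt_min hr₀ one_half_pos
  have hr₁1 : r₁ ≤ 1 / 2 := min_le_right _ _
  have hr₁r : r₁ ≤ r₀ := min_le_left _ _
  -- a good radius `R ∈ (max (1-η) (1/2), 1)` around `0`
  obtain ⟨R, hR, hgR⟩ := exists_radius_not_mem hH 0
    (show max (1 - η) (1 / 2) < 1 from max_lt (by linarith) (by norm_num))
  have hR1 : R < 1 := hR.2
  have hRη : 1 - η < R := (le_max_left _ _).trans_lt hR.1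
  have hRh : 1 / 2 < R := (le_max_right _ _).trans_lt hR.1
  -- a linking good circle around `x = R/2` of radius `s ∈ (R/2, R/2 + ε)`
  set ε : ℝ := min r₁ ((1 - R) / 2) with hε
  have hε0 : 0 < ε := lt_min hr₁0 (by linarith)
  have hεr : ε ≤ r₁ := min_le_left _ _
  have hεR : ε ≤ (1 - R) / 2 := min_le_right _ _
  set x : ℂ := ((R / 2 : ℝ) : ℂ) with hx
  have hxn : ‖x‖ = R / 2 := by
    rw [hx, Complex.norm_real, Real.norm_eq_abs, abs_of_pos (by linarith)]
  have hx0 : x ≠ 0 := fun h ↦ by rw [h, norm_zero] at hxn; linarith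
  obtain ⟨s, hs, hgs⟩ := exists_radius_not_mem hH x (show R / 2 < R / 2 + ε by linarith)
  have hs0 : 0 < s := by linarith [hs.1]
  -- the linking set `V = ball 0 r₁ ∪ sphere x s ∪ sphere 0 R`
  have hV : IsPreconnected (ball (0 : ℂ) r₁ ∪ sphere x s ∪ sphere 0 R) := by
    obtain ⟨z₁, hz₁s, hz₁n⟩ := exists_mem_sphere_norm_eq hx0 hs0.le (R := s - R / 2)
      (by rw [hxn, abs_sub_comm, abs_of_nonneg (by linarith [hs.1])])
      (by rw [hxn]; linarith)
    obtain ⟨z₂, hz₂s, hz₂n⟩ := exists_mem_sphere_norm_eq hx0 hs0.le (R := R)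
      (by rw [hxn, abs_sub_comm, abs_of_nonneg (by linarith [hs.1])]; linarith [hs.2])
      (by rw [hxn]; linarith [hs.1])
    have hA : IsPreconnected (ball (0 : ℂ) r₁) := (convex_ball 0 r₁).isPreconnected
    have hAB : IsPreconnected (ball (0 : ℂ) r₁ ∪ sphere x s) :=
      IsPreconnected.union' ⟨z₁, mem_ball_zero_iff.2 (by rw [hz₁n]; linarith [hs.2]), hz₁s⟩ hA
        (isPreconnected_sphere h2 _ _)
    exact IsPreconnected.union' ⟨z₂, Or.inr hz₂s, mem_sphere_zero_iff_norm.2 hz₂n⟩ hAB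
      (isPreconnected_sphere h2 _ _)
  have hVsub : ball (0 : ℂ) r₁ ∪ sphere x s ∪ sphere 0 R ⊆ ball 0 1 \ closure (poleSet u) := by
    rintro z ((hz | hz) | hz)
    · have hzn : ‖z‖ < r₁ := mem_ball_zero_iff.1 hz
      refine ⟨mem_ball_zero_iff.2 (by linarith), fun hzcl ↦ ?_⟩
      have := hclos hzcl
      simp only [mem_setOf_eq] at this
      linarith
    · exact hgood hgs (by rw [hxn]; linarith [hs.2]) hz
    · exact hgood hgR (by rw [norm_zero, zero_add]; exact hR1) hz
  exact ⟨R, ⟨hRη, hR1⟩, subset_union_right.trans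
    (hV.subset_connectedComponentIn (Or.inl (Or.inl (mem_ball_self hr₁0))) hVsub)⟩

end Summit.RiemannHypothesis.RiemannHypothesis.Theorems.Splittings.ScrewBorelGauss
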